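import Summits.QuantumFields.BalabanUV.T4Continuum.Support.NE7EtaBackgroundGaugeLetterDischarge
import Summits.QuantumFields.BalabanUV.T4Continuum.Support.NE7EtaBackgroundRefineThresholds
import HarnessLib

/-!
# NE7EtaBackgroundRefineDischarge — route #1 of the NE7 crux, stub S7 (NODE O, the BACKGROUND COORDINATE), part 2 of the (H2) discharge:
# `NE7EtaBackgroundGaugeLetterDischarge.hclose_of_refine_regular` (p263433) WITH ITS (H2) REFINEMENT BINDER `h2` DISCHARGED and its (H3) binder
# read from (H3ˢᵘᵖ) — NODE O's `hclose` binder now costs NE3's covariant root + (H3ˢᵘᵖ) + numerics + the sector condition ONLY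

Cell `pub-balaban`, rung (B)+1 sub-cell t4, lineage `b2b-balaban-t4-ne7-p1`, generation 27 (CRUX PROVER NE7 #1, ruling e34b3e0c); crux
skeleton `t4/skeletons/NE7-CRUX-R1.md` v1.7.7 §0bis item 7 ∕ §3septies ∕ §5 (G5).  HONEST FRAMING (page 1): FIXED FINITE T⁴, rung (B)+1; NE7, NE3
NOT PRINTED in [Balaban1984PropagatorsI]–[Balaban1989LargeFieldII] and NOT PROVED here; continuum YM on T⁴ ⇐ BetaPertH ∧ nine spine estimates
(0/9 proved); BetaPertH ⇐ (D1) ∧ (D4) ∧ CAP+tail; G-an2-4 gates asym, D1 and NE2/3/4; NOT infinite volume, NOT mass gap, NOT Clay.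

WHAT ([folklore]; 0 def; 0 sorry; composition of part 1 `NE7EtaBackgroundRefineThresholds` with p263433):
 * **`refine_of_regularSup_four`** — at `d = 4`, for `L ≥ 1`, radii `0 ≤ b ≤ t`, `0 ≤ c ≤ t` with `2^91·L^17·t ≤ 1` and `2^76·L^12·t ≤ ε`, data
   `dom ⊆ sfClass 4 L N ε₁ 0` (`ε₁ ≤ 1∕4`, `ε₁ ≤ b`, `4ε₁ ≤ c`) and (H3ˢᵘᵖ) for the `sfClass`-minimisers of runs `k+1`: `b ≤ ε` and THE SHAPE `h2` of
   p259117∕p263433 («every minimiser of every run `k` is the rescaled one-step average of SOME configuration of `sfClass 4 L N ε (k+1)`»).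
 * **`hclose_of_regularSup`** = `NE7EtaBackgroundGaugeLetterDischarge.hclose_of_refine_regular` WITH `h2` DISCHARGED and `h3` REPLACED by (H3ˢᵘᵖ)
   (`RegularSup.regular` ∘ `Regular.mono`, any `g ≥ gradConst 4 c`): the `hclose` binder of NODE O's background coordinate now costs EXACTLY row NE3's
   covariant root `h` (INTERFACE REQUEST NE7→NE3 amendment 4, VERBATIM), row NE3's (H3ˢᵘᵖ) `h3` ([Balaban1985Variational] Thm 1 (8)+(10) p. 279
   TYPE, asserted for nothing), the data class, the smallness letters (`2^91·L^17·t ≤ 1`, `2^76·L^12·t ≤ ε`, `16·C₀·ε ≤ 3`, `40960·L²·ε ≤ 1`,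
   `LevelSmall`), `hdom`, the budget letters `hγ3`∕`hΛl₁`, and the sector condition `|n|·N²·ε ≤ sectorConst n` — NO kinematic hypothesis is left;
   conclusion VERBATIM that of p263433.
CONSEQUENCE FOR THE BILL (skeleton §0bis item 7 ∕ §5 (G5)): «row NE3's (H2)(H3)» becomes «row NE3's (H3ˢᵘᵖ)»; nothing in the ask of NE3 (amendment 4),
nothing in the composition; route 1 stays KERNEL-COMPLETE AT FORM LEVEL, DEPENDENT; NE7 NOT proved.
HONEST: composition only; the discharged binder is KINEMATIC, not an estimate of Bałaban's; (H3ˢᵘᵖ) and NE3's covariant root remain hypotheses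
asserted for no configuration; 0 def; 0 sorry.
-/

set_option autoImplicit false

open scoped BigOperators Matrix Matrix.Norms.L2Operator
open Finset NormedSpace

namespace Summit.QuantumFields.BalabanUV.T4Continuum.NE7EtaBackgroundRefineDischarge

open Literature.MathematicalPhysics.QuantumFieldTheory.Balaban1983to89
open B7Prop1Explicit B7Prop2Explicit
open T4AveragingDeficitWall hiding Site Plane Plaq Bond
open T4AveragingDeficitWallBoundary (periodBox IsPeriodicCfg)
open MinimalActionSandwich (IsMinimiser)
open MinimalActionRate (Regular sfClass)
open MinimalActionRefine (RegularSup gradConst gradConst_nonneg)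
open T4OutputRate (Carriers)
open AveragingDeficitPeriodicCounting (IsPeriodicDir)
open AveragingDeficitMultiLevelPrep (LevelSmall)
open NE3EnergyShapes (residualScale IsUnitarySite IsPeriodicSite)
open NE3EnergyWeightedShapes (energyNormW)
open AveragingDeficitDualResidual (dualC1 dualC2)
open AveragingDeficitDerivWallProof (wallConst)
open NE7EtaBackgroundCarrier NE7EtaBackgroundCloseness
open TorusSmallFieldGlobalGauge (sectorConst gaugeConst)
open NE7EtaBackgroundGaugeLetterDischarge (hclose_of_refine_regular)
open NE7EtaBackgroundRefineThresholds (smoothRefine_sfClass_thm1Type refine_of_smoothRefine thresholds_four classRadius_four)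

noncomputable section

/-! ## The NE7 consumer at `d = 4`: `h2` DISCHARGED, `h3` := (H3ˢᵘᵖ) -/

variable {n : Type} [Fintype n] [DecidableEq n] [Nonempty n]

/-- **THE `h2` SHAPE AT `d = 4` UNDER TWO NUMERIC LETTERS**: for `L ≥ 1`, `0 ≤ b ≤ t`, `0 ≤ c ≤ t`, `2^91·L^17·t ≤ 1`, `2^76·L^12·t ≤ ε`, data
`dom ⊆ sfClass 4 L N ε₁ 0` with `ε₁ ≤ 1∕4`, `ε₁ ≤ b`, `4ε₁ ≤ c`, and (H3ˢᵘᵖ) for the `sfClass`-minimisers of runs `k+1`: `b ≤ ε` and every minimiser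
of every run `k` is the rescaled one-step average of SOME configuration of `sfClass 4 L N ε (k+1)` (`refine_of_smoothRefine` ∘
`smoothRefine_sfClass_thm1Type` ∘ `thresholds_four` ∕ `classRadius_four`). [folklore] -/
theorem refine_of_regularSup_four {L N : ℕ} (hL : 1 ≤ L) {b c t ε ε₁ : ℝ} (hb : 0 ≤ b) (hc : 0 ≤ c) (hbt : b ≤ t) (hct : c ≤ t)
    (hsmall : (2 : ℝ) ^ 91 * (L : ℝ) ^ 17 * t ≤ 1) (hεt : (2 : ℝ) ^ 76 * (L : ℝ) ^ 12 * t ≤ ε)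
    (hε₁ : ε₁ ≤ 1 / 4) (hε₁b : ε₁ ≤ b) (hε₁c : 4 * ε₁ ≤ c)
    {dom : Set (Site 4 → Fin 4 → (Matrix n n ℂ)ˣ)} (hdom1 : dom ⊆ sfClass 4 L N ε₁ 0)
    (h3 : ∀ V ∈ dom, ∀ (k : ℕ) (U : Site 4 → Fin 4 → (Matrix n n ℂ)ˣ),
      IsMinimiser 4 (sfClass 4 L N ε) L N (k + 1) V U → RegularSup 4 L N b c (k + 1) U) :
    b ≤ ε ∧ ∀ V ∈ dom, ∀ (k : ℕ) (U : Site 4 → Fin 4 → (Matrix n n ℂ)ˣ), IsMinimiser 4 (sfClass 4 L N ε) L N k V U →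
      ∃ Ut, Ut ∈ sfClass 4 L N ε (k + 1) ∧ rescale L (bavg L Ut) = U := by
  have ht0 : 0 ≤ t := hb.trans hbt
  obtain ⟨hT1, hT2, hT3⟩ := thresholds_four hL ht0 hsmall
  have hE := classRadius_four hL ht0 hεt
  obtain ⟨hbε, b', c', hR⟩ := smoothRefine_sfClass_thm1Type (d := 4) (n := n) (by norm_num) N hL hb hc hbt hct hT1 hT2 hT3 hE
  exact ⟨hbε, refine_of_smoothRefine hε₁ hε₁b hε₁c hR hdom1 h3⟩

/-- **NODE O's `hclose` BINDER WITH (H2) DISCHARGED** — `NE7EtaBackgroundGaugeLetterDischarge.hclose_of_refine_regular` (p263433) with its binder `h2`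
PROVED (`refine_of_regularSup_four`) and its binder `h3` (`Regular 4 L N b g (k+1)`) derived from (H3ˢᵘᵖ) (`RegularSup.regular`, `Regular.mono`, any
`g ≥ gradConst 4 c`); the letters `0 ≤ ε`, `b ≤ ε`, `512·5·8·L²·b ≤ 1` and `dom ⊆ sfClass 4 L N ε 0` of p263433 follow from the displayed numerics and
the data class.  REMAINING HYPOTHESES (all displayed): row NE3's covariant root `h` (INTERFACE REQUEST NE7→NE3 amendment 4, VERBATIM as in p263433),
row NE3's (H3ˢᵘᵖ) `h3` ([Balaban1985Variational] Thm 1 (8)+(10) p. 279 TYPE — a hypothesis SHAPE asserted for no configuration), the data class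
`dom ⊆ sfClass 4 L N ε₁ 0` (`ε₁ ≤ 1∕4`, `ε₁ ≤ b`, `4ε₁ ≤ c`), radii `0 ≤ b ≤ t`, `0 ≤ c ≤ t` with `2^91·L^17·t ≤ 1` and `2^76·L^12·t ≤ ε`, the class
regime `16·C₀·ε ≤ 3`, `1024·5·8·L²·ε ≤ 1`, K-free `LevelSmall`, `hdom`, the budget letters `hγ3`∕`hΛl₁`, and the sector condition
`|n|·N²·ε ≤ sectorConst n` (NEEDS-SIDE-CONDITION #S1).  Conclusion VERBATIM that of p263433.  NE3∕NE7 NOT proved. [folklore] -/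
theorem hclose_of_regularSup {L N : ℕ} (hL : 2 ≤ L) (hN : 1 ≤ N) {θ : ℝ} (hθ : 0 < θ)
    (hθ6 : θ ^ 6 = ((L : ℝ))⁻¹) {ε ε₁ b c t : ℝ} (hb : 0 ≤ b) (hc : 0 ≤ c) (hbt : b ≤ t) (hct : c ≤ t)
    (hsmall : (2 : ℝ) ^ 91 * (L : ℝ) ^ 17 * t ≤ 1) (hεt : (2 : ℝ) ^ 76 * (L : ℝ) ^ 12 * t ≤ ε)
    (hε1 : 16 * C0 4 * ε ≤ 3) (hε2 : 1024 * (4 + 1) * (4 + 4) * (L : ℝ) ^ 2 * ε ≤ 1)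
    (hls : ∀ j : ℕ, LevelSmall 4 L j (ε / ((L : ℝ) ^ (j + 1)) ^ 2))
    (hε₁ : ε₁ ≤ 1 / 4) (hε₁b : ε₁ ≤ b) (hε₁c : 4 * ε₁ ≤ c)
    {g C Λ₁ Λ₂' : ℝ} (hgc : gradConst 4 c ≤ g) (hC : 0 ≤ C) (hΛ₂' : 0 < Λ₂')
    {dom : Set (Site 4 → Fin 4 → (Matrix n n ℂ)ˣ)} (hdom1 : dom ⊆ sfClass 4 L N ε₁ 0)
    (hdom : ∀ v ∈ dom, ∀ w : Site 4 → (Matrix n n ℂ)ˣ, IsUnitarySite w → IsPeriodicSite w (N : ℤ) → gaugeAct w v ∈ dom)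
    (h3 : ∀ V ∈ dom, ∀ (k : ℕ) (U : Site 4 → Fin 4 → (Matrix n n ℂ)ˣ),
      IsMinimiser 4 (sfClass 4 L N ε) L N (k + 1) V U → RegularSup 4 L N b c (k + 1) U)
    (h : ∀ k : ℕ, 1 ≤ k → ∀ V ∈ dom, ∀ UA UB : Site 4 → Fin 4 → (Matrix n n ℂ)ˣ,
      IsMinimiser 4 (sfClass 4 L N ε) L N k V UA → IsMinimiser 4 (sfClass 4 L N ε) L N (k + 1) V UB →
        Regular 4 L N b g (k + 1) UB →
        ∃ (u : Site 4 → (Matrix n n ℂ)ˣ) (Z : Site 4 → Fin 4 → Matrix n n ℂ),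
          IsUnitarySite u ∧ IsPeriodicSite u ((N * L ^ k : ℕ) : ℤ) ∧
          IsSkewDir Z ∧ IsPeriodicDir Z ((N * L ^ k : ℕ) : ℤ) ∧
          gaugeAct u UA = vary (rescale L (bavg L UB)) Z 1 ∧
          energyNormW L k (rescale L (bavg L UB)) Z (periodBox (N * L ^ k)) ≤ C * residualScale 4 L N b g k ∧
          (∀ (κ : Fin 4) (x : Site 4) (μ : Fin 4),
            ‖Ad (rescale L (bavg L UB) (x + e κ) μ) (Z (x + e μ) κ) - Z x κ‖ ≤ Λ₁ * (((L : ℝ)⁻¹) ^ k) ^ 2) ∧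
          (∀ (κ μ : Fin 4) (y : Site 4),
            ‖Ad (rescale L (bavg L UB) (y + e κ) μ)
                (Ad (rescale L (bavg L UB) (y + e κ + e μ) μ) (Z (y + (2 : ℕ) • e μ) κ) - Z (y + e μ) κ)
              - (Ad (rescale L (bavg L UB) (y + e κ) μ) (Z (y + e μ) κ) - Z y κ)‖ ≤ Λ₂' * (((L : ℝ)⁻¹) ^ k) ^ 3))
    {γ l₁ : ℝ} (hγ : 0 < γ)
    (hγ3 : C * (wallConst 4 L * (N : ℝ) ^ 2 * (Real.sqrt g * dualC2 4 L + 2 * b ^ 2 * dualC1 4 L)) ≤ γ ^ 3)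
    (hl₁ : 0 < l₁) (hΛl₁ : Λ₁ ≤ l₁ ^ 3)
    (hsector : (Fintype.card n : ℝ) * (N : ℝ) ^ 2 * ε ≤ sectorConst n)
    (D : Type) (sc : D → ℕ) (dl : D → ℝ) (hdl : ∀ X, 0 ≤ dl X) :
    ∃ (uA : ℕ → (Site 4 → Fin 4 → (Matrix n n ℂ)ˣ) → (occCarriers n L N ε dom D sc dl hdl).BgA)
      (uB : ℕ → (Site 4 → Fin 4 → (Matrix n n ℂ)ˣ) → (occCarriers n L N ε dom D sc dl hdl).BgB) (K₀ : ℕ) (C₃ : ℝ),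
      0 ≤ C₃ ∧
      (∀ K : ℕ, K₀ ≤ K → ∀ v ∈ dom, ∃ (UA UB : Site 4 → Fin 4 → (Matrix n n ℂ)ˣ) (wA wB : Site 4 → (Matrix n n ℂ)ˣ),
        IsMinimiser 4 (sfClass 4 L N ε) L N K v UA ∧ IsMinimiser 4 (sfClass 4 L N ε) L N (K + 1) v UB ∧
        Regular 4 L N b g (K + 1) UB ∧ IsUnitarySite wA ∧ IsPeriodicSite wA ((N * L ^ K : ℕ) : ℤ) ∧
        IsUnitarySite wB ∧ IsPeriodicSite wB ((N * L ^ (K + 1) : ℕ) : ℤ) ∧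
        (uA K v).1 = (K, gaugeAct wA UA) ∧ (uB K v).1 = (K, gaugeAct wB UB)) ∧
      (∀ (K : ℕ) (v : Site 4 → Fin 4 → (Matrix n n ℂ)ˣ), ¬ (K₀ ≤ K ∧ v ∈ dom) →
        (uA K v).1 = (K, 1) ∧ (uB K v).1 = (K, 1)) ∧
      ∀ K : ℕ, ∀ v ∈ dom, (occCarriers n L N ε dom D sc dl hdl).gauge (uA K v)
          ((occCarriers n L N ε dom D sc dl hdl).transport (uB K v))
        ≤ C₃ * θ ^ K := by
  have hL1 : 1 ≤ L := le_trans (by norm_num) hL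
  have hL1r : (1 : ℝ) ≤ L := by exact_mod_cast hL1
  have ht0 : 0 ≤ t := hb.trans hbt
  -- (H2) discharged and `b ≤ ε`
  obtain ⟨hbε, h2⟩ := refine_of_regularSup_four hL1 hb hc hbt hct hsmall hεt hε₁ hε₁b hε₁c hdom1 h3
  have hε : 0 ≤ ε := hb.trans hbε
  -- `512·5·8·L²·b ≤ 1` from the numeric threshold
  have hbs : 512 * (4 + 1) * (4 + 4) * (L : ℝ) ^ 2 * b ≤ 1 := by
    have hL2 : (L : ℝ) ^ 2 ≤ (L : ℝ) ^ 17 := pow_le_pow_right₀ hL1r (by norm_num)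
    have hL20 : 0 ≤ (L : ℝ) ^ 2 := by positivity
    have h1 : 512 * (4 + 1) * (4 + 4) * (L : ℝ) ^ 2 * b ≤ (2 : ℝ) ^ 91 * (L : ℝ) ^ 17 * t := by
      have h20480 : (512 * (4 + 1) * (4 + 4) : ℝ) ≤ (2 : ℝ) ^ 91 := by norm_num
      calc 512 * (4 + 1) * (4 + 4) * (L : ℝ) ^ 2 * b ≤ (2 : ℝ) ^ 91 * (L : ℝ) ^ 17 * b := by
            apply mul_le_mul_of_nonneg_right _ hb
            exact mul_le_mul h20480 hL2 hL20 (by positivity)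
        _ ≤ (2 : ℝ) ^ 91 * (L : ℝ) ^ 17 * t := mul_le_mul_of_nonneg_left hbt (by positivity)
    exact h1.trans hsmall
  -- the data class lies in the run class at level `0` (`ε₁ ≤ b ≤ ε`)
  have hdom0 : dom ⊆ sfClass 4 L N ε 0 := by
    intro V hV
    obtain ⟨hu, hp, hs⟩ := hdom1 hV
    exact ⟨hu, hp, MinimalActionRate.SmallField.mono hs (div_le_div_of_nonneg_right (hε₁b.trans hbε) (by positivity))⟩
  -- (H3) in `ℓ²` form from (H3ˢᵘᵖ)
  have hg : 0 ≤ g := (gradConst_nonneg (d := 4) c).trans hgc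
  have h3reg : ∀ V ∈ dom, ∀ (k : ℕ) (U : Site 4 → Fin 4 → (Matrix n n ℂ)ˣ),
      IsMinimiser 4 (sfClass 4 L N ε) L N (k + 1) V U → Regular 4 L N b g (k + 1) U :=
    fun V hV k U hU => ((h3 V hV k U hU).regular).mono le_rfl hgc
  exact hclose_of_refine_regular hL hN hθ hθ6 hε hε1 hε2 hls hb hbε hbs hg hC hΛ₂' hdom0 hdom h2 h3reg h hγ hγ3 hl₁ hΛl₁
    hsector D sc dl hdl


end

end Summit.QuantumFields.BalabanUV.T4Continuum.NE7EtaBackgroundRefineDischarge
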